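import Mathlib
import HarnessLib

/-!
# Route `PoloidalWindowDoor`, crux `PoloidalWindowRigidity` (K2, stmt-NavierStokesRegularity-19708) —
# HORIZONTAL MEANS at a large scale: calculus tools (no fluid mechanics)

Cell ns-regularity-ideate, seat ns-poloidal-K2-p2 (stub-worker, gen 2; support lemmas `--supports` the crux,
`--as helper`).  Tooling for the (M)-consuming exclusion of the CONSTANT-SHEAR («wave») stratum of the residue
(companion file `…ConstantShear`): averages of a function on `ℝ³` over HORIZONTAL planes `{x₂ = c₂ + z}` against a
bump of width `R`,

  `hmean φ c R z F = ∫_{y ∈ ℝ²} F(c + R·(y₀,y₁,0) + z e₂) φ̄(y) dy`,  `φ̄ = φ.normed` (mass one, `φ̄ ≥ 0`),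

and the four facts the large-scale argument uses:

* `hmean_hasDerivAt_height` — `d/dz ⟨F⟩ = ⟨∂₂F⟩` (differentiation under the integral, compact support);
* `hmean_hasDerivAt_time` — `d/dt ⟨F(t)⟩ = ⟨∂ₜF(t)⟩` for a jointly continuously differentiable family;
* `hmean_fderiv_horizontal`, `abs_hmean_fderiv_horizontal_le` — ONE INTEGRATION BY PARTS in a horizontal direction:
  `⟨∂_bΦ⟩ = −R⁻¹ ∫ Φ ∂_bφ̄`, so `|⟨∂_bΦ⟩| ≤ R⁻¹ · sup|Φ| · ‖∂_bφ̄‖₁` — horizontal divergences are `O(1/R)`;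
* `hmean_sq_sub_sq_eq`, `hmean_variance_nonneg`, `abs_hmean_cube_centred_le` — Jensen: the horizontal variance
  `⟨F²⟩ − ⟨F⟩²` is `⟨(F − ⟨F⟩)²⟩ ≥ 0`, and `|⟨(F−⟨F⟩)³⟩| ≤ sup|F−⟨F⟩| · (⟨F²⟩ − ⟨F⟩²)`.

WHAT THIS IS NOT: not a claim about Navier–Stokes — parametric-integral bookkeeping (bears_on LADDER-NS N0, rung
N0-LocalTubeDoorPoloidal, crux K2).
-/

noncomputable section

-- the summit and its single sub-problem share the name (CONVENTIONS §1), as in every Theorems file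
set_option linter.dupNamespace false

namespace Summit.NavierStokesRegularity.NavierStokesRegularity.Theorems.PoloidalWindowDoorPoloidalWindowRigidityHorizontalMean

open MeasureTheory Set Function Filter Topology Metric
open scoped RealInnerProductSpace InnerProductSpace ContDiff

/-! ### Horizontal planes -/

/-- The horizontal embedding `(y₀, y₁) ↦ (y₀, y₁, 0)` of `ℝ²` in `ℝ³`, as a continuous linear map. -/
def hor : EuclideanSpace ℝ (Fin 2) →L[ℝ] EuclideanSpace ℝ (Fin 3) :=
  (EuclideanSpace.proj (0 : Fin 2) : EuclideanSpace ℝ (Fin 2) →L[ℝ] ℝ).smulRight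
      (EuclideanSpace.single (0 : Fin 3) (1 : ℝ)) +
    (EuclideanSpace.proj (1 : Fin 2) : EuclideanSpace ℝ (Fin 2) →L[ℝ] ℝ).smulRight
      (EuclideanSpace.single (1 : Fin 3) (1 : ℝ))

/-- `hor y = y₀ e₀ + y₁ e₁`. -/
theorem hor_apply (y : EuclideanSpace ℝ (Fin 2)) :
    hor y = (y 0) • EuclideanSpace.single (0 : Fin 3) (1 : ℝ) + (y 1) • EuclideanSpace.single (1 : Fin 3) (1 : ℝ) := by
  simp [hor]

/-- `hor e_b = e_b` for the two horizontal directions (`b = 0, 1`, cast into `Fin 3`). -/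
theorem hor_single (b : Fin 2) :
    hor (EuclideanSpace.single b (1 : ℝ)) = EuclideanSpace.single (Fin.castSucc b) (1 : ℝ) := by
  rw [hor_apply]
  fin_cases b <;> simp

/-- The point of the horizontal plane through `c + z e₂` with (scaled) horizontal coordinate `y`:
`pt c R z y = c + R·hor y + z e₂`. -/
def pt (c : EuclideanSpace ℝ (Fin 3)) (R z : ℝ) (y : EuclideanSpace ℝ (Fin 2)) : EuclideanSpace ℝ (Fin 3) :=
  c + R • hor y + z • EuclideanSpace.single (2 : Fin 3) (1 : ℝ)

/-- The height of `pt c R z y` is `c₂ + z`, whatever `y`. -/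
theorem pt_apply_two (c : EuclideanSpace ℝ (Fin 3)) (R z : ℝ) (y : EuclideanSpace ℝ (Fin 2)) :
    pt c R z y 2 = c 2 + z := by
  simp [pt, hor_apply]

/-- `pt` is continuous in `y`. -/
theorem continuous_pt (c : EuclideanSpace ℝ (Fin 3)) (R z : ℝ) : Continuous (pt c R z) := by
  unfold pt; fun_prop

/-- `pt` is jointly continuous in `(z, y)`. -/
theorem continuous_pt_uncurry (c : EuclideanSpace ℝ (Fin 3)) (R : ℝ) :
    Continuous (fun p : ℝ × EuclideanSpace ℝ (Fin 2) => pt c R p.1 p.2) := by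
  unfold pt; fun_prop

/-- The `y`-derivative of `pt c R z`: the constant map `R·hor`. -/
theorem hasFDerivAt_pt (c : EuclideanSpace ℝ (Fin 3)) (R z : ℝ) (y : EuclideanSpace ℝ (Fin 2)) :
    HasFDerivAt (pt c R z) (R • hor) y := by
  have h1 : HasFDerivAt (fun y : EuclideanSpace ℝ (Fin 2) => R • hor y) (R • hor) y :=
    (hor.hasFDerivAt).const_smul R
  exact (h1.const_add c).add_const (z • EuclideanSpace.single (2 : Fin 3) (1 : ℝ))

/-- The `z`-derivative of `z ↦ pt c R z y`: the vertical unit vector `e₂`. -/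
theorem hasDerivAt_pt_height (c : EuclideanSpace ℝ (Fin 3)) (R z : ℝ) (y : EuclideanSpace ℝ (Fin 2)) :
    HasDerivAt (fun z' => pt c R z' y) (EuclideanSpace.single (2 : Fin 3) (1 : ℝ)) z := by
  unfold pt
  have h := ((hasDerivAt_id z).smul_const (EuclideanSpace.single (2 : Fin 3) (1 : ℝ))).const_add (c + R • hor y)
  simpa using h

/-! ### The horizontal mean -/

/-- The HORIZONTAL MEAN of `F : ℝ³ → ℝ` on the plane through `c + z e₂`, at scale `R`, against the normalised bump
`φ`: `∫ F(c + R·hor y + z e₂) φ̄(y) dy`. -/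
def hmean (φ : ContDiffBump (0 : EuclideanSpace ℝ (Fin 2))) (c : EuclideanSpace ℝ (Fin 3)) (R z : ℝ)
    (F : EuclideanSpace ℝ (Fin 3) → ℝ) : ℝ :=
  ∫ y, F (pt c R z y) * φ.normed volume y

variable (φ : ContDiffBump (0 : EuclideanSpace ℝ (Fin 2))) (c : EuclideanSpace ℝ (Fin 3)) (R z : ℝ)

/-- The integrand of a horizontal mean of a continuous function is integrable (continuous, compact support). -/
theorem integrable_mul_normed {G : EuclideanSpace ℝ (Fin 2) → ℝ} (hG : Continuous G) :
    Integrable (fun y => G y * φ.normed volume y) := by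
  refine Continuous.integrable_of_hasCompactSupport (hG.mul φ.continuous_normed) ?_
  exact φ.hasCompactSupport_normed.mul_left

/-- The mean of a function that is constant on the plane is that constant (`∫ φ̄ = 1`). -/
theorem hmean_eq_of_forall_eq {F : EuclideanSpace ℝ (Fin 3) → ℝ} {a : ℝ} (h : ∀ y, F (pt c R z y) = a) :
    hmean φ c R z F = a := by
  simp only [hmean, h, integral_const_mul, φ.integral_normed, mul_one]

/-- The mean of a constant. -/
theorem hmean_const (a : ℝ) : hmean φ c R z (fun _ => a) = a :=
  hmean_eq_of_forall_eq φ c R z fun _ => rfl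

/-- Additivity of the mean (continuous integrands). -/
theorem hmean_add {F G : EuclideanSpace ℝ (Fin 3) → ℝ} (hF : Continuous F) (hG : Continuous G) :
    hmean φ c R z (fun x => F x + G x) = hmean φ c R z F + hmean φ c R z G := by
  simp only [hmean, add_mul]
  exact integral_add (integrable_mul_normed φ (hF.comp (continuous_pt c R z)))
    (integrable_mul_normed φ (hG.comp (continuous_pt c R z)))

/-- The mean of a difference (continuous integrands). -/
theorem hmean_sub {F G : EuclideanSpace ℝ (Fin 3) → ℝ} (hF : Continuous F) (hG : Continuous G) :
    hmean φ c R z (fun x => F x - G x) = hmean φ c R z F - hmean φ c R z G := by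
  simp only [hmean, sub_mul]
  exact integral_sub (integrable_mul_normed φ (hF.comp (continuous_pt c R z)))
    (integrable_mul_normed φ (hG.comp (continuous_pt c R z)))

/-- Homogeneity of the mean. -/
theorem hmean_const_mul (F : EuclideanSpace ℝ (Fin 3) → ℝ) (a : ℝ) :
    hmean φ c R z (fun x => a * F x) = a * hmean φ c R z F := by
  simp only [hmean, mul_assoc, integral_const_mul]

/-- Monotonicity of the mean (`φ̄ ≥ 0`). -/
theorem hmean_mono {F G : EuclideanSpace ℝ (Fin 3) → ℝ} (hF : Continuous F) (hG : Continuous G)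
    (h : ∀ x, F x ≤ G x) : hmean φ c R z F ≤ hmean φ c R z G :=
  integral_mono (integrable_mul_normed φ (hF.comp (continuous_pt c R z)))
    (integrable_mul_normed φ (hG.comp (continuous_pt c R z)))
    fun y => mul_le_mul_of_nonneg_right (h _) (φ.nonneg_normed y)

/-- Positivity of the mean. -/
theorem hmean_nonneg {F : EuclideanSpace ℝ (Fin 3) → ℝ} (h : ∀ x, 0 ≤ F x) : 0 ≤ hmean φ c R z F :=
  integral_nonneg fun y => mul_nonneg (h _) (φ.nonneg_normed y)

/-- `|⟨F⟩| ≤ M` when `|F| ≤ M`. -/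
theorem abs_hmean_le {F : EuclideanSpace ℝ (Fin 3) → ℝ} (hF : Continuous F) {M : ℝ} (h : ∀ x, |F x| ≤ M) :
    |hmean φ c R z F| ≤ M := by
  have hM : hmean φ c R z (fun _ => M) = M := hmean_const φ c R z M
  have hm : hmean φ c R z (fun _ => -M) = -M := hmean_const φ c R z (-M)
  rw [abs_le]
  constructor
  · rw [← hm]
    exact hmean_mono φ c R z continuous_const hF fun x => (abs_le.1 (h x)).1
  · rw [← hM]
    exact hmean_mono φ c R z hF continuous_const fun x => (abs_le.1 (h x)).2

/-- `|⟨F G⟩| ≤ M ⟨G⟩` when `|F| ≤ M` and `G ≥ 0`. -/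
theorem abs_hmean_mul_le_of_nonneg {F G : EuclideanSpace ℝ (Fin 3) → ℝ} (hF : Continuous F) (hG : Continuous G)
    {M : ℝ} (h : ∀ x, |F x| ≤ M) (h0 : ∀ x, 0 ≤ G x) :
    |hmean φ c R z (fun x => F x * G x)| ≤ M * hmean φ c R z G := by
  rw [← hmean_const_mul, abs_le]
  constructor
  · have : hmean φ c R z (fun x => -(M * G x)) ≤ hmean φ c R z (fun x => F x * G x) :=
      hmean_mono φ c R z ((continuous_const.mul hG).neg) (hF.mul hG) fun x => by
        have := (abs_le.1 (h x)).1; nlinarith [h0 x]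
    simpa [hmean, neg_mul, integral_neg] using this
  · exact hmean_mono φ c R z (hF.mul hG) (continuous_const.mul hG) fun x => by
      have := (abs_le.1 (h x)).2; nlinarith [h0 x]

/-! ### Jensen: the horizontal variance -/

/-- `⟨F²⟩ − ⟨F⟩² = ⟨(F − ⟨F⟩)²⟩`. -/
theorem hmean_sq_sub_sq_eq {F : EuclideanSpace ℝ (Fin 3) → ℝ} (hF : Continuous F) :
    hmean φ c R z (fun x => F x ^ 2) - hmean φ c R z F ^ 2 =
      hmean φ c R z (fun x => (F x - hmean φ c R z F) ^ 2) := by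
  set m := hmean φ c R z F with hm
  have hexp : (fun x => (F x - m) ^ 2) = fun x => F x ^ 2 + (-(2 * m) * F x + m ^ 2) := by
    funext x; ring
  have h1 : hmean φ c R z (fun x => (F x - m) ^ 2) =
      hmean φ c R z (fun x => F x ^ 2) +
        (hmean φ c R z (fun x => -(2 * m) * F x) + hmean φ c R z (fun _ => m ^ 2)) := by
    rw [hexp, hmean_add φ c R z (F := fun x => F x ^ 2) (G := fun x => -(2 * m) * F x + m ^ 2) (hF.pow 2)
        ((continuous_const.mul hF).add continuous_const),
      hmean_add φ c R z (F := fun x => -(2 * m) * F x) (G := fun _ => m ^ 2) (continuous_const.mul hF)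
        continuous_const]
  rw [h1, hmean_const_mul, hmean_const, ← hm]
  ring

/-- The horizontal variance is nonnegative: `⟨F⟩² ≤ ⟨F²⟩`. -/
theorem hmean_variance_nonneg {F : EuclideanSpace ℝ (Fin 3) → ℝ} (hF : Continuous F) :
    0 ≤ hmean φ c R z (fun x => F x ^ 2) - hmean φ c R z F ^ 2 := by
  rw [hmean_sq_sub_sq_eq φ c R z hF]
  exact hmean_nonneg φ c R z fun x => sq_nonneg _

/-- Third centred moment against the variance: `|⟨(F−m)³⟩| ≤ sup|F−m| · (⟨F²⟩ − m²)`, `m = ⟨F⟩`. -/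
theorem abs_hmean_cube_centred_le {F : EuclideanSpace ℝ (Fin 3) → ℝ} (hF : Continuous F) {M : ℝ}
    (h : ∀ x, |F x - hmean φ c R z F| ≤ M) :
    |hmean φ c R z (fun x => (F x - hmean φ c R z F) ^ 3)| ≤
      M * (hmean φ c R z (fun x => F x ^ 2) - hmean φ c R z F ^ 2) := by
  rw [hmean_sq_sub_sq_eq φ c R z hF]
  have hc : Continuous fun x => F x - hmean φ c R z F := hF.sub continuous_const
  have heq : (fun x => (F x - hmean φ c R z F) ^ 3) =
      fun x => (F x - hmean φ c R z F) * (F x - hmean φ c R z F) ^ 2 := by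
    funext x; ring
  rw [heq]
  exact abs_hmean_mul_le_of_nonneg φ c R z hc (hc.pow 2) h fun x => sq_nonneg _

/-! ### Differentiation under the integral sign -/

/-- **Parametric derivative against a compactly supported continuous weight.** If `G` and `G'` are jointly
continuous on `S × ℝ²` (`S` open) and `∂ₛG(s,y) = G'(s,y)` there, then
`d/ds ∫ G(s,y) w(y) dy = ∫ G'(s,y) w(y) dy` at every `s₀ ∈ S`. -/
theorem hasDerivAt_integral_mul_of_hasCompactSupport {S : Set ℝ} (hS : IsOpen S) {s₀ : ℝ} (hs₀ : s₀ ∈ S)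
    {G G' : ℝ → EuclideanSpace ℝ (Fin 2) → ℝ} (hG : ContinuousOn (uncurry G) (S ×ˢ univ))
    (hG' : ContinuousOn (uncurry G') (S ×ˢ univ)) (hd : ∀ s ∈ S, ∀ y, HasDerivAt (fun σ => G σ y) (G' s y) s)
    {w : EuclideanSpace ℝ (Fin 2) → ℝ} (hw : Continuous w) (hwc : HasCompactSupport w) :
    HasDerivAt (fun s => ∫ y, G s y * w y) (∫ y, G' s₀ y * w y) s₀ := by
  -- a compact parameter interval inside `S`
  obtain ⟨δ, hδ, hball⟩ : ∃ δ > 0, closedBall s₀ δ ⊆ S := by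
    obtain ⟨ε, hε, hεS⟩ := Metric.isOpen_iff.1 hS s₀ hs₀
    exact ⟨ε / 2, half_pos hε, (closedBall_subset_ball (half_lt_self hε)).trans hεS⟩
  -- slices are continuous
  have hslice : ∀ s ∈ S, Continuous (G s) := fun s hs =>
    hG.comp_continuous (continuous_const.prodMk continuous_id) fun y => mk_mem_prod hs (mem_univ y)
  have hslice' : ∀ s ∈ S, Continuous (G' s) := fun s hs =>
    hG'.comp_continuous (continuous_const.prodMk continuous_id) fun y => mk_mem_prod hs (mem_univ y)
  -- a uniform bound for `G'` on `closedBall s₀ δ × tsupport w`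
  set K : Set (ℝ × EuclideanSpace ℝ (Fin 2)) := closedBall s₀ δ ×ˢ tsupport w with hK
  have hKc : IsCompact K := (isCompact_closedBall s₀ δ).prod hwc
  have hKS : K ⊆ S ×ˢ univ := prod_mono hball (subset_univ _)
  obtain ⟨B, hB⟩ := hKc.exists_bound_of_continuousOn (hG'.mono hKS)
  refine (hasDerivAt_integral_of_dominated_loc_of_deriv_le (μ := volume) (F := fun s y => G s y * w y)
    (F' := fun s y => G' s y * w y) (bound := fun y => B * |w y|) (ball_mem_nhds s₀ hδ) ?_ ?_ ?_ ?_ ?_ ?_).2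
  · filter_upwards [ball_mem_nhds s₀ hδ] with s hs
    exact ((hslice s (hball (ball_subset_closedBall hs))).mul hw).aestronglyMeasurable
  · exact (hslice s₀ hs₀).mul hw |>.integrable_of_hasCompactSupport hwc.mul_left
  · exact ((hslice' s₀ hs₀).mul hw).aestronglyMeasurable
  · refine Eventually.of_forall fun y s hs => ?_
    rw [norm_mul, Real.norm_eq_abs (w y)]
    by_cases hy : y ∈ tsupport w
    · exact mul_le_mul_of_nonneg_right (hB (s, y) ⟨ball_subset_closedBall hs, hy⟩) (abs_nonneg _)
    · have : w y = 0 := image_eq_zero_of_notMem_tsupport hy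
      simp [this]
  · exact ((continuous_const.mul hw.abs).integrable_of_hasCompactSupport hwc.abs.mul_left)
  · exact Eventually.of_forall fun y s hs => (hd s (hball (ball_subset_closedBall hs)) y).mul_const (w y)

/-- **Height derivative of a horizontal mean**: `d/dz ⟨F⟩(z) = ⟨∂₂F⟩(z)` for `F ∈ C¹(ℝ³)`. -/
theorem hmean_hasDerivAt_height {F : EuclideanSpace ℝ (Fin 3) → ℝ} (hF : ContDiff ℝ 1 F) :
    HasDerivAt (fun z' => hmean φ c R z' F)
      (hmean φ c R z (fun x => fderiv ℝ F x (EuclideanSpace.single (2 : Fin 3) (1 : ℝ)))) z := by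
  unfold hmean
  have hFc : Continuous F := hF.continuous
  have hF'c : Continuous fun x => fderiv ℝ F x (EuclideanSpace.single (2 : Fin 3) (1 : ℝ)) :=
    (hF.continuous_fderiv one_ne_zero).clm_apply continuous_const
  refine hasDerivAt_integral_mul_of_hasCompactSupport isOpen_univ (mem_univ z)
    (G := fun z' y => F (pt c R z' y))
    (G' := fun z' y => fderiv ℝ F (pt c R z' y) (EuclideanSpace.single (2 : Fin 3) (1 : ℝ)))
    ?_ ?_ ?_ φ.continuous_normed φ.hasCompactSupport_normed
  · exact (hFc.comp (continuous_pt_uncurry c R)).continuousOn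
  · exact (hF'c.comp (continuous_pt_uncurry c R)).continuousOn
  · intro z' _ y
    have h1 : HasFDerivAt F (fderiv ℝ F (pt c R z' y)) (pt c R z' y) :=
      (hF.differentiable one_ne_zero _).hasFDerivAt
    exact h1.comp_hasDerivAt z' (hasDerivAt_pt_height c R z' y)

/-- **Time derivative of a horizontal mean**: if `F` and `Fₜ` are jointly continuous on the open slab `S × ℝ³` and
`∂ₜF(t,x) = Fₜ(t,x)` there, then `d/dt ⟨F(t)⟩ = ⟨Fₜ(t)⟩` at every `t ∈ S`. -/
theorem hmean_hasDerivAt_time {S : Set ℝ} (hS : IsOpen S) {t : ℝ} (ht : t ∈ S)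
    {F Ft : ℝ → EuclideanSpace ℝ (Fin 3) → ℝ} (hF : ContinuousOn (uncurry F) (S ×ˢ univ))
    (hFt : ContinuousOn (uncurry Ft) (S ×ˢ univ))
    (hd : ∀ τ ∈ S, ∀ x, HasDerivAt (fun σ => F σ x) (Ft τ x) τ) :
    HasDerivAt (fun τ => hmean φ c R z (F τ)) (hmean φ c R z (Ft t)) t := by
  unfold hmean
  have hp : ContinuousOn (fun q : ℝ × EuclideanSpace ℝ (Fin 2) => (q.1, pt c R z q.2)) (S ×ˢ univ) :=
    (continuous_fst.prodMk ((continuous_pt c R z).comp continuous_snd)).continuousOn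
  have hmaps : MapsTo (fun q : ℝ × EuclideanSpace ℝ (Fin 2) => (q.1, pt c R z q.2)) (S ×ˢ univ) (S ×ˢ univ) :=
    fun q hq => mk_mem_prod hq.1 (mem_univ _)
  refine hasDerivAt_integral_mul_of_hasCompactSupport hS ht
    (G := fun τ y => F τ (pt c R z y)) (G' := fun τ y => Ft τ (pt c R z y))
    (hF.comp hp hmaps) (hFt.comp hp hmaps) (fun τ hτ y => hd τ hτ _) φ.continuous_normed φ.hasCompactSupport_normed

/-! ### One horizontal integration by parts -/

/-- The `L¹` norm of a horizontal derivative of the normalised bump: the constant in the `O(1/R)` bounds. -/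
def bumpDerivNorm (b : Fin 2) : ℝ :=
  ∫ y, |fderiv ℝ (φ.normed volume) y (EuclideanSpace.single b (1 : ℝ))|

/-- `‖∂_bφ̄‖₁ ≥ 0`. -/
theorem bumpDerivNorm_nonneg (b : Fin 2) : 0 ≤ bumpDerivNorm φ b :=
  integral_nonneg fun _ => abs_nonneg _

/-- The horizontal derivative of the normalised bump is continuous with compact support. -/
theorem continuous_fderiv_normed (b : Fin 2) :
    Continuous fun y => fderiv ℝ (φ.normed volume) y (EuclideanSpace.single b (1 : ℝ)) :=
  ((φ.contDiff_normed (n := 1)).continuous_fderiv (by norm_num)).clm_apply continuous_const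

/-- … and compactly supported. -/
theorem hasCompactSupport_fderiv_normed (b : Fin 2) :
    HasCompactSupport fun y => fderiv ℝ (φ.normed volume) y (EuclideanSpace.single b (1 : ℝ)) :=
  (φ.hasCompactSupport_normed.fderiv (𝕜 := ℝ)).comp_left (g := fun L : EuclideanSpace ℝ (Fin 2) →L[ℝ] ℝ =>
    L (EuclideanSpace.single b (1 : ℝ))) (by simp)

/-- **Horizontal integration by parts.** For `Φ ∈ C¹(ℝ³)` and `R ≠ 0`, the mean of the horizontal derivative
`∂_bΦ` (`b = 0,1`) is `−R⁻¹ ∫ Φ(pt) ∂_bφ̄`. -/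
theorem hmean_fderiv_horizontal {Φ : EuclideanSpace ℝ (Fin 3) → ℝ} (hΦ : ContDiff ℝ 1 Φ) (hR : R ≠ 0) (b : Fin 2) :
    hmean φ c R z (fun x => fderiv ℝ Φ x (EuclideanSpace.single (Fin.castSucc b) (1 : ℝ))) =
      -R⁻¹ * ∫ y, Φ (pt c R z y) * fderiv ℝ (φ.normed volume) y (EuclideanSpace.single b (1 : ℝ)) := by
  unfold hmean
  set g : EuclideanSpace ℝ (Fin 2) → ℝ := fun y => Φ (pt c R z y) with hg
  have hΦd : Differentiable ℝ Φ := hΦ.differentiable one_ne_zero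
  -- chain rule: `∂_b g = R · (∂_b Φ)(pt)`
  have hgd : ∀ y, HasFDerivAt g ((fderiv ℝ Φ (pt c R z y)).comp (R • hor)) y := fun y =>
    (hΦd _).hasFDerivAt.comp y (hasFDerivAt_pt c R z y)
  have hgb : ∀ y, fderiv ℝ g y (EuclideanSpace.single b (1 : ℝ)) =
      R * fderiv ℝ Φ (pt c R z y) (EuclideanSpace.single (Fin.castSucc b) (1 : ℝ)) := by
    intro y
    rw [(hgd y).fderiv, ContinuousLinearMap.comp_apply, FunLike.coe_smul, Pi.smul_apply, hor_single,
      map_smul, smul_eq_mul]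
  have hgc : Continuous g := hΦ.continuous.comp (continuous_pt c R z)
  have hg'c : Continuous fun y => fderiv ℝ g y (EuclideanSpace.single b (1 : ℝ)) := by
    simp_rw [hgb]
    exact continuous_const.mul (((hΦ.continuous_fderiv one_ne_zero).clm_apply continuous_const).comp
      (continuous_pt c R z))
  -- integration by parts on `ℝ²` against the compactly supported bump
  have hibp := integral_mul_fderiv_eq_neg_fderiv_mul_of_integrable (μ := (volume : Measure (EuclideanSpace ℝ (Fin 2))))
    (f := g) (g := φ.normed volume) (v := EuclideanSpace.single b (1 : ℝ)) ?_ ?_ ?_ ?_ ?_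
  · -- `∫ g ∂_bφ̄ = −∫ ∂_b g φ̄`
    have h1 : ∫ y, fderiv ℝ g y (EuclideanSpace.single b (1 : ℝ)) * φ.normed volume y =
        R * ∫ y, fderiv ℝ Φ (pt c R z y) (EuclideanSpace.single (Fin.castSucc b) (1 : ℝ)) * φ.normed volume y := by
      simp_rw [hgb, mul_assoc]
      exact integral_const_mul _ _
    have h2 : R * ∫ y, fderiv ℝ Φ (pt c R z y) (EuclideanSpace.single (Fin.castSucc b) (1 : ℝ)) * φ.normed volume y =
        -∫ y, g y * fderiv ℝ (φ.normed volume) y (EuclideanSpace.single b (1 : ℝ)) := by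
      rw [← h1, hibp, neg_neg]
    have h3 := congrArg (fun s => R⁻¹ * s) h2
    simp only [← mul_assoc, inv_mul_cancel₀ hR, one_mul] at h3
    rw [h3]
    ring
  · exact (hg'c.mul φ.continuous_normed).integrable_of_hasCompactSupport φ.hasCompactSupport_normed.mul_left
  · exact (hgc.mul (continuous_fderiv_normed φ b)).integrable_of_hasCompactSupport
      (hasCompactSupport_fderiv_normed φ b).mul_left
  · exact (hgc.mul φ.continuous_normed).integrable_of_hasCompactSupport φ.hasCompactSupport_normed.mul_left
  · exact fun y _ => (hgd y).differentiableAt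
  · exact fun y _ => (φ.contDiff_normed (n := 1)).differentiable (by norm_num) y

/-- **Horizontal derivatives average to `O(1/R)`**: `|⟨∂_bΦ⟩| ≤ R⁻¹ · M · ‖∂_bφ̄‖₁` whenever `|Φ| ≤ M`, `R > 0`. -/
theorem abs_hmean_fderiv_horizontal_le {Φ : EuclideanSpace ℝ (Fin 3) → ℝ} (hΦ : ContDiff ℝ 1 Φ) (hR : 0 < R)
    (b : Fin 2) {M : ℝ} (hM : ∀ x, |Φ x| ≤ M) :
    |hmean φ c R z (fun x => fderiv ℝ Φ x (EuclideanSpace.single (Fin.castSucc b) (1 : ℝ)))| ≤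
      R⁻¹ * M * bumpDerivNorm φ b := by
  rw [hmean_fderiv_horizontal φ c R z hΦ hR.ne' b, abs_mul, abs_neg, abs_inv, abs_of_pos hR, mul_assoc]
  refine mul_le_mul_of_nonneg_left ?_ (inv_nonneg.2 hR.le)
  calc |∫ y, Φ (pt c R z y) * fderiv ℝ (φ.normed volume) y (EuclideanSpace.single b (1 : ℝ))|
      ≤ ∫ y, |Φ (pt c R z y) * fderiv ℝ (φ.normed volume) y (EuclideanSpace.single b (1 : ℝ))| :=
        abs_integral_le_integral_abs
    _ ≤ ∫ y, M * |fderiv ℝ (φ.normed volume) y (EuclideanSpace.single b (1 : ℝ))| := by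
        refine integral_mono_of_nonneg (Eventually.of_forall fun y => abs_nonneg _) ?_
          (Eventually.of_forall fun y => ?_)
        · exact ((continuous_const.mul (continuous_fderiv_normed φ b).abs).integrable_of_hasCompactSupport
            (hasCompactSupport_fderiv_normed φ b).abs.mul_left)
        · dsimp only
          rw [abs_mul]
          exact mul_le_mul_of_nonneg_right (hM _) (abs_nonneg _)
    _ = M * bumpDerivNorm φ b := by rw [integral_const_mul]; rfl

end Summit.NavierStokesRegularity.NavierStokesRegularity.Theorems.PoloidalWindowDoorPoloidalWindowRigidityHorizontalMean

end
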